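import Summits.CriticalPhenomena.PercolationContinuityZ3.Theses.PercTorusSliceFilling
import Summits.CriticalPhenomena.PercolationContinuityZ3.Theorems.PercNearOneGluingNoHeavyLowerTailCSHTheoremOne
import Summits.CriticalPhenomena.PercolationContinuityZ3.Theorems.PercTorusSliceFillingNoCriticalTorusGiantNecessity
import HarnessLib

/-!
# `PercTorusSliceFilling.NoCriticalTorusGiant` (stmt-CriticalPhenomena-5407) — SETTLED after continuity

Item `stmt-CriticalPhenomena-5407` of route `CriticalPhenomena/PercTorusSliceFilling` (crux r2, 'T-B'): for Bernoulli
bond percolation on the discrete torus `(ℤ/nℤ)³` at the `ℤ³`-critical parameter `p_c(ℤ³)`, for every `ε > 0` the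
probability that some open cluster has at least `ε n³` vertices tends to `0` as `n → ∞`.

The tree already holds the NECESSITY direction `θ(p_c(ℤ³)) = 0 ⇒ NoCriticalTorusGiant`
(`PercTorusSliceFillingNoCriticalTorusGiant.noCriticalTorusGiant_of_theta_eq_zero`, support file
`…NoCriticalTorusGiantNecessity.lean`: the finite-range stochastic domination of the torus cluster by the `ℤ³`
cluster, Benjamini–Schramm 1996 Thm. 1 / Heydenreich–van der Hofstad 2017 Prop. 13.7, via the box chart, plus the
first-moment Markov inequality over the `n³` vertices and `P_{p_c}(|C(0)| ≥ m+1) ↓ θ(p_c)`), and `θ(p_c(ℤ³)) = 0` is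
p205010 (`CSH.percolationContinuityZ3_holds`).  This file composes the two.  No rate is claimed; the converse
items of the route (TorusNonProliferation, ThinClusterRarity) are untouched.

builds on p205010 (kernel theorem, internal audit signed; external expert review pending) — USED
(`CSH.percolationContinuityZ3_holds`).  RSW3 lane, prover P2 gen 32 (prover-prim-rsw3-p2-g32-0), METHOD '3D RSW-lite
from continuity'.
References: I. Benjamini, O. Schramm (1996), Thm. 1 [BenjaminiSchramm1996]; M. Heydenreich, R. van der Hofstad (2017),
Prop. 13.7 [HeydenreichVanDerHofstad2017]; G. Kozma, N. Nitzan (2024) [KozmaNitzan2024].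
-/

noncomputable section

namespace Summit.CriticalPhenomena.PercolationContinuityZ3.Theorems

namespace TorusSliceFillingNoCriticalTorusGiant

open Literature.Probability.Percolation Literature.Probability.LatticeModels

/-- **`PercTorusSliceFilling.NoCriticalTorusGiant` (stmt-CriticalPhenomena-5407), settled**: necessity
(`noCriticalTorusGiant_of_theta_eq_zero`) at `θ(p_c(ℤ³)) = 0` (p205010).
[cite: KozmaNitzan2024, Thm. 6 with Conj. 3 (p. 15)] -/
theorem noCriticalTorusGiant_proof :
    Summit.CriticalPhenomena.PercolationContinuityZ3.Theses.PercTorusSliceFilling.NoCriticalTorusGiant :=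
  PercTorusSliceFillingNoCriticalTorusGiant.noCriticalTorusGiant_of_theta_eq_zero CSH.percolationContinuityZ3_holds

end TorusSliceFillingNoCriticalTorusGiant

end Summit.CriticalPhenomena.PercolationContinuityZ3.Theorems

end
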